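import Summits.HubbardSuperconductivity.HubbardSuperconductivity.Theorems.BalabanIRBirEveryGroundStateTransfer
import Summits.HubbardSuperconductivity.HubbardSuperconductivity.Theorems.BalabanIRBirEveryGroundStateLogic
import Summits.HubbardSuperconductivity.HubbardSuperconductivity.Theorems.BalabanIRBirEveryGroundStateSourceShift
import Summits.HubbardSuperconductivity.HubbardSuperconductivity.Theorems.BalabanIRBirEveryGroundStateSocketResidues
import Summits.HubbardSuperconductivity.HubbardSuperconductivity.Theorems.BalabanIRBirEveryGroundStateSocketMoments
import Summits.HubbardSuperconductivity.HubbardSuperconductivity.Theorems.BalabanIRBirEveryGroundStateSectorPBHubbard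

/-!
# STRATEGY-CENSUS sketch — crux `BirEveryGroundState` (stmt-HubbardSuperconductivity-2083), route BalabanIR
crux-strategist (wall-breaker) planner-cstrat-stmt-HubbardSuperconductivity-2083-p1-0, 2026-08-17.

This scratch file TYPE-CHECKS the signatures quoted in `STRATEGY-CENSUS.md`:
* §Strengthen — `IrreducibleGroundLaw` (S⁺, hypothesis-free) and `S⁺ → crux` (landed closer);
* §Decomposition — `RobustnessUpgradeLaw` (Sub_R) and `MomentBudgetLaw` (Sub_M), each `→ crux` by a
  landed closer: every typed split is ONE hard ∀-window law + landed glue (k = 1 in substance);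
* §Door (route level, for the tenure planner / human) — the conjugate-source re-cut:
  `BirShiftedAverageLRO` (target X'_avg: the target's own matrix for the κ-penalised Hamiltonian at
  ONE (δ,U)), `BirGappedPhaseReductionRS := 2R → 3 → X'_avg`, and `closes_recut : 2R → 3 → 4RS → S`
  proved from the landed `Theorems.hubbardSuperconductivity_of_shiftedAverage` — crux 5 is no longer a
  hypothesis of the deciding theorem.
Nothing here is proposed to the tree; it is evidence for the census.
-/

noncomputable section

namespace Summit.HubbardSuperconductivity.HubbardSuperconductivity.Cruxes.BirEveryGroundState.StrategyCensus

open Matrix Finset Filter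
open Literature.Probability.LatticeModels Literature.MathematicalPhysics.QuantumLattice
open Summit.HubbardSuperconductivity.HubbardSuperconductivity.Theorems
open Summit.HubbardSuperconductivity.HubbardSuperconductivity.Theses.BalabanIR
open scoped ComplexOrder

/-! ## §Strengthen — S⁺ = the hypothesis-free irreducibility law -/

/-- S⁺ (hypothesis-free, refutable in principle, NOT insulated by the open target): in every
repulsive window there is a coupling at which, eventually in even `L`, the sector ground eigenspace
is irreducible under the joint commutant of `{H(U), N̂, S^z, Δ_d†Δ_d}` (verbatim the residual
`hirr` of the landed closer `birEveryGroundState_structural_of_irreducibleGround`). -/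
def IrreducibleGroundLaw : Prop :=
  ∀ δ ∈ Set.Ioo (0:ℝ) (1/2), ∀ U₁ U₂ : ℝ, 0 < U₁ → U₁ < U₂ →
    ∃ U ∈ Set.Ioo U₁ U₂, ∃ L₀ : ℕ, ∀ (L : ℕ) [NeZero L], L₀ ≤ L → Even L →
      let N : ℕ := 2 * ⌊(1 - δ) * (L : ℝ) ^ 2 / 2⌋₊
      let H := hubbardTorus 2 L 1 U
      let S := szSector (Λ := FermionTorus 2 L) N 0
      let E₀ := S ⊓ Module.End.eigenspace (Matrix.toLin' H) ((H.minEnergyOn S : ℝ) : ℂ)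
      let Y : Matrix (Finset (Orb (FermionTorus 2 L))) (Finset (Orb (FermionTorus 2 L))) ℂ :=
        (pairField dWaveFormFactor L)ᴴ * pairField dWaveFormFactor L
      ∀ K' : Submodule ℂ (Fock (Orb (FermionTorus 2 L))), K' ≤ E₀ →
        (∀ X : Matrix (Finset (Orb (FermionTorus 2 L))) (Finset (Orb (FermionTorus 2 L))) ℂ,
          X * H = H * X → X * totalNumber = totalNumber * X →
          X * HubbardWave0.spinZ = HubbardWave0.spinZ * X → X * Y = Y * X →
          ∀ v ∈ K', X *ᵥ v ∈ K') →
        K' = ⊥ ∨ K' = E₀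

/-- S⁺ closes the crux BY NAME (landed closer; the route decl unfolds to the structural body). -/
theorem birEveryGroundState_of_irreducibleGroundLaw (h : IrreducibleGroundLaw) :
    BirEveryGroundState :=
  birEveryGroundState_structural_of_irreducibleGround h

/-! ## §Decomposition — the two best typed splits; each is ONE hard law + landed glue -/

/-- Sub_R, the robustness-upgrade law: window GS-average order ⇒ at ONE coupling of the window the
SHIFTED (κ-penalised, `Y_L = L⁻⁴Δ_d†Δ_d`) GS-average order, eventually in even `L`, for some
`κ_L > 0` (verbatim the hypothesis of the landed `birEveryGroundState_structural_of_shiftedAverage`).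
A ∀-window Hubbard law, insulated exactly like the crux (its negation needs the window-average
hypothesis TRUE somewhere) and false in the abstract (Disproof §2 pencil: the penalty makes the dark
partner THE ground state of `H + κY`). -/
def RobustnessUpgradeLaw : Prop :=
  ∀ (δ U₁ U₂ c : ℝ), δ ∈ Set.Ioo (0:ℝ) (1/2) → 0 < U₁ → U₁ < U₂ → 0 < c →
    (∀ U ∈ Set.Ioo U₁ U₂, ∃ L₀ : ℕ, ∀ (L : ℕ) [NeZero L], L₀ ≤ L → Even L →
      let N : ℕ := 2 * ⌊(1 - δ) * (L : ℝ) ^ 2 / 2⌋₊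
      let H := hubbardTorus 2 L 1 U
      let S := szSector (Λ := FermionTorus 2 L) N 0
      let E₀ := S ⊓ Module.End.eigenspace (Matrix.toLin' H) ((H.minEnergyOn S : ℝ) : ℂ)
      let P := projMatrix (E₀.map (Fock.toEuclidean (ι := Orb (FermionTorus 2 L)) :
        Fock (Orb (FermionTorus 2 L)) →ₗ[ℂ] EuclideanSpace ℂ (Finset (Orb (FermionTorus 2 L)))))
      c * (L : ℝ) ^ 4 * P.trace.re ≤
        (P * ((pairField dWaveFormFactor L)ᴴ * pairField dWaveFormFactor L)).trace.re) →
    ∃ U ∈ Set.Ioo U₁ U₂, ∃ c' : ℝ, 0 < c' ∧ ∃ L₀ : ℕ, ∀ (L : ℕ) [NeZero L], L₀ ≤ L → Even L →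
      ∃ κ : ℝ, 0 < κ ∧
      let N : ℕ := 2 * ⌊(1 - δ) * (L : ℝ) ^ 2 / 2⌋₊
      let H := hubbardTorus 2 L 1 U
      let S := szSector (Λ := FermionTorus 2 L) N 0
      let Yd : Matrix (Finset (Orb (FermionTorus 2 L))) (Finset (Orb (FermionTorus 2 L))) ℂ :=
        ((1 : ℂ) / (L : ℂ) ^ 4) • ((pairField dWaveFormFactor L)ᴴ * pairField dWaveFormFactor L)
      let E := S ⊓ Module.End.eigenspace (Matrix.toLin' (H + (κ : ℂ) • Yd))
        ((((H + (κ : ℂ) • Yd).minEnergyOn S : ℝ)) : ℂ)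
      let P := projMatrix (E.map (Fock.toEuclidean (ι := Orb (FermionTorus 2 L)) :
        Fock (Orb (FermionTorus 2 L)) →ₗ[ℂ] EuclideanSpace ℂ (Finset (Orb (FermionTorus 2 L)))))
      c' * (L : ℝ) ^ 4 * P.trace.re ≤
        (P * ((pairField dWaveFormFactor L)ᴴ * pairField dWaveFormFactor L)).trace.re

/-- Glue of the split `Sub_R → crux` (landed). -/
theorem birEveryGroundState_of_robustnessUpgradeLaw (h : RobustnessUpgradeLaw) :
    BirEveryGroundState :=
  birEveryGroundState_structural_of_shiftedAverage h

/-- Sub_M, the moment–budget law (RESHAPE-ideator1's R-M cut, as ONE ∀-window law): window average ⇒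
at one coupling the average clause, the second-moment clause `tr(POPO)·tr P ≤ (1+ε)(tr PO)²` and the
budget `tr P ≤ D` with `εD ≤ 1/4` (verbatim the hypothesis of the landed
`birEveryGroundState_structural_of_moments`). The budget half is weak and plausible; the moment half
fails exactly in the dark-partner scenario (Samuelson is sharp), so it remains the whole crux. -/
def MomentBudgetLaw : Prop :=
  ∀ (δ U₁ U₂ c : ℝ), δ ∈ Set.Ioo (0:ℝ) (1/2) → 0 < U₁ → U₁ < U₂ → 0 < c →
    (∀ U ∈ Set.Ioo U₁ U₂, ∃ L₀ : ℕ, ∀ (L : ℕ) [NeZero L], L₀ ≤ L → Even L →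
      let N : ℕ := 2 * ⌊(1 - δ) * (L : ℝ) ^ 2 / 2⌋₊
      let H := hubbardTorus 2 L 1 U
      let S := szSector (Λ := FermionTorus 2 L) N 0
      let E₀ := S ⊓ Module.End.eigenspace (Matrix.toLin' H) ((H.minEnergyOn S : ℝ) : ℂ)
      let P := projMatrix (E₀.map (Fock.toEuclidean (ι := Orb (FermionTorus 2 L)) :
        Fock (Orb (FermionTorus 2 L)) →ₗ[ℂ] EuclideanSpace ℂ (Finset (Orb (FermionTorus 2 L)))))
      c * (L : ℝ) ^ 4 * P.trace.re ≤
        (P * ((pairField dWaveFormFactor L)ᴴ * pairField dWaveFormFactor L)).trace.re) →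
    ∃ U ∈ Set.Ioo U₁ U₂, ∃ c' ε D : ℝ, 0 < c' ∧ 0 ≤ ε ∧ ε * D ≤ 1 / 4 ∧
      ∃ L₀ : ℕ, ∀ (L : ℕ) [NeZero L], L₀ ≤ L → Even L →
      let N : ℕ := 2 * ⌊(1 - δ) * (L : ℝ) ^ 2 / 2⌋₊
      let H := hubbardTorus 2 L 1 U
      let S := szSector (Λ := FermionTorus 2 L) N 0
      let E₀ := S ⊓ Module.End.eigenspace (Matrix.toLin' H) ((H.minEnergyOn S : ℝ) : ℂ)
      let P := projMatrix (E₀.map (Fock.toEuclidean (ι := Orb (FermionTorus 2 L)) :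
        Fock (Orb (FermionTorus 2 L)) →ₗ[ℂ] EuclideanSpace ℂ (Finset (Orb (FermionTorus 2 L)))))
      let O := (pairField dWaveFormFactor L)ᴴ * pairField dWaveFormFactor L
      c' * (L : ℝ) ^ 4 * P.trace.re ≤ (P * O).trace.re ∧
        (P * O * P * O).trace.re * P.trace.re ≤ (1 + ε) * (P * O).trace.re ^ 2 ∧
        P.trace.re ≤ D

/-- Glue of the split `Sub_M → crux` (landed). -/
theorem birEveryGroundState_of_momentBudgetLaw (h : MomentBudgetLaw) : BirEveryGroundState :=
  birEveryGroundState_structural_of_moments h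

/-! ## §Negation — a counterexample must first PROVE the route's open target (landed logic) -/

/-- Any refutation of the crux is a proof of `BirGroundStateAverageLRO` (the route's rank-0 target). -/
example (h : ¬ BirEveryGroundState) : BirGroundStateAverageLRO :=
  birGroundStateAverageLRO_of_not_birEveryGroundState h

/-! ## §Door (route level) — the conjugate-source re-cut, typed and certified against the tree -/

/-- X'_avg, the re-cut target: the target's OWN matrix (a ground-state-average trace inequality) at
ONE `(δ, U)`, for the κ-penalised Hamiltonian `H + κ L⁻⁴ Δ_d†Δ_d` with `κ = κ_L > 0` chosen per
side (verbatim the hypothesis of the landed `Theorems.hubbardSuperconductivity_of_shiftedAverage`). -/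
def BirShiftedAverageLRO : Prop :=
  ∃ δ ∈ Set.Ioo (0:ℝ) (1/2), ∃ U : ℝ, 0 < U ∧ ∃ c : ℝ, 0 < c ∧ ∃ L₀ : ℕ,
    ∀ (L : ℕ) [NeZero L], L₀ ≤ L → Even L → ∃ κ : ℝ, 0 < κ ∧
    let N : ℕ := 2 * ⌊(1 - δ) * (L : ℝ) ^ 2 / 2⌋₊
    let H := hubbardTorus 2 L 1 U
    let S := szSector (Λ := FermionTorus 2 L) N 0
    let Yd : Matrix (Finset (Orb (FermionTorus 2 L))) (Finset (Orb (FermionTorus 2 L))) ℂ :=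
      ((1 : ℂ) / (L : ℂ) ^ 4) • ((pairField dWaveFormFactor L)ᴴ * pairField dWaveFormFactor L)
    let E := S ⊓ Module.End.eigenspace (Matrix.toLin' (H + (κ : ℂ) • Yd))
      ((((H + (κ : ℂ) • Yd).minEnergyOn S : ℝ)) : ℂ)
    let P := projMatrix (E.map (Fock.toEuclidean (ι := Orb (FermionTorus 2 L)) :
      Fock (Orb (FermionTorus 2 L)) →ₗ[ℂ] EuclideanSpace ℂ (Finset (Orb (FermionTorus 2 L)))))
    c * (L : ℝ) ^ 4 * P.trace.re ≤
      (P * ((pairField dWaveFormFactor L)ᴴ * pairField dWaveFormFactor L)).trace.re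

/-- 4RS, the reduction re-typed to feed X'_avg (same antecedents as the route's crux 4R). -/
def BirGappedPhaseReductionRS : Prop :=
  BirComplexStableXYR → BirBdGPhaseCoercivity → BirShiftedAverageLRO

/-- THE RE-CUT DECIDING THEOREM: engine 2R, coercivity 3 and the re-typed reduction 4RS decide the
summit WITHOUT crux 5 (`BirEveryGroundState`) — "every ground state" is free by concavity in the
conjugate source (landed `hubbardSuperconductivity_of_shiftedAverage`). -/
theorem closes_recut (h2R : BirComplexStableXYR) (h3 : BirBdGPhaseCoercivity)
    (h4RS : BirGappedPhaseReductionRS) : _root_.HubbardSuperconductivity :=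
  hubbardSuperconductivity_of_shiftedAverage (h4RS h2R h3)

/-- Sanity: crux 3 is already proved in the route file, so the re-cut route has exactly TWO open
hypotheses (2R and 4RS). -/
example (h2R : BirComplexStableXYR) (h4RS : BirGappedPhaseReductionRS) :
    _root_.HubbardSuperconductivity :=
  closes_recut h2R BirBdGPhaseCoercivity_holds h4RS

/-! ### The engine-facing (thermal, R-T) variant of the same door -/

/-- X'_th, the THERMAL re-cut target (R-T): at ONE `(δ, U)`, eventually in even `L`, some `κ, β > 0`
have `a + L² log 4/(βκ) ≤ ⟨Y_L⟩_{β,κ}`, the sector-canonical Gibbs average of `Y_L = L⁻⁴Δ_d†Δ_d` in the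
κ-penalised ensemble (verbatim the hypothesis of the landed
`Theorems.hubbardSuperconductivity_of_penalisedThermalAverage`; finite β = finite Trotter extent `M`,
the regime a functional-integral engine actually controls). -/
def BirPenalisedThermalLRO : Prop :=
  ∃ δ ∈ Set.Ioo (0:ℝ) (1/2), ∃ U : ℝ, 0 < U ∧ ∃ a : ℝ, 0 < a ∧ ∃ L₀ : ℕ,
    ∀ (L : ℕ) [NeZero L], L₀ ≤ L → Even L → ∃ κ β : ℝ, 0 < κ ∧ 0 < β ∧
    let N : ℕ := 2 * ⌊(1 - δ) * (L : ℝ) ^ 2 / 2⌋₊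
    let H := hubbardTorus 2 L 1 U
    let S := szSector (Λ := FermionTorus 2 L) N 0
    let PS := projMatrix (S.map (Fock.toEuclidean (ι := Orb (FermionTorus 2 L)) :
      Fock (Orb (FermionTorus 2 L)) →ₗ[ℂ] EuclideanSpace ℂ (Finset (Orb (FermionTorus 2 L)))))
    let Yd : Matrix (Finset (Orb (FermionTorus 2 L))) (Finset (Orb (FermionTorus 2 L))) ℂ :=
      ((1 : ℂ) / (L : ℂ) ^ 4) • ((pairField dWaveFormFactor L)ᴴ * pairField dWaveFormFactor L)
    a + (L : ℝ) ^ 2 * Real.log 4 / (β * κ) ≤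
      (PS * gibbsWeight β (H + (κ : ℂ) • Yd) * Yd).trace.re /
        (PS * gibbsWeight β (H + (κ : ℂ) • Yd)).trace.re

/-- 4RT, the reduction re-typed to feed X'_th. -/
def BirGappedPhaseReductionRT : Prop :=
  BirComplexStableXYR → BirBdGPhaseCoercivity → BirPenalisedThermalLRO

/-- THE THERMAL RE-CUT DECIDING THEOREM (no crux 5, no β → ∞ limit, no genericity). -/
theorem closes_recut_thermal (h2R : BirComplexStableXYR) (h3 : BirBdGPhaseCoercivity)
    (h4RT : BirGappedPhaseReductionRT) : _root_.HubbardSuperconductivity :=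
  hubbardSuperconductivity_of_penalisedThermalAverage (h4RT h2R h3)

end Summit.HubbardSuperconductivity.HubbardSuperconductivity.Cruxes.BirEveryGroundState.StrategyCensus
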